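import Literature.NumberTheory.EllipticCurves.ModularSymbolsProofs
import Mathlib.Analysis.Fourier.AddCircle
import Mathlib.Analysis.SpecialFunctions.Integrals.Basic
import HarnessLib

/-!
# Parseval's formula along horocycles for cuspidal `q`-series of period `h`

Topic `NumberTheory/EllipticCurves` (modular forms), namespace
`Literature.NumberTheory.EllipticCurves.ModularForms.IsCuspFunction`. For a cuspidal `q`-series
function `φ` of period `h > 0` on `ℍ` (`IsCuspFunction h φ` of `ModularSymbolsProofs`: `φ` holomorphic,
`φ ∘ ofComplex` `h`-periodic, `φ → 0` at `i∞`; e.g. `f |_k g` for `f ∈ S_k(Γ₀(N))`, `g ∈ SL₂(ℤ)`,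
`h = N`) with `q`-expansion `φ = Σ_{n ≥ 1} cₙ e^{2πinτ/h}` we PROVE

* `hasSum_horizontal` — `φ(x + it) = Σₙ cₙ e^{-2πnt/h} e^{2πinx/h}`;
* `fourierCoeffOn_horizontal` — the Fourier coefficients of the `h`-periodic function
  `x ↦ φ(x + it)` on `[0, h]`: `cₙ e^{-2πnt/h}` for `n ≥ 0` and `0` for `n < 0` (termwise
  integration, Mathlib `intervalIntegral.hasSum_integral_of_dominated_convergence`, and the
  orthogonality `∫₀ʰ e^{2πimx/h} dx = h·[m = 0]`, `integral_exp_two_pi_mul_I_mul`);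
* `integral_norm_sq_horizontal` — **Parseval**:
  `∫₀ʰ |φ(x + it)|² dx = h Σₙ |cₙ|² e^{-4πnt/h}` (`t > 0`), from Mathlib's
  `hasSum_sq_fourierCoeffOn` (Rankin 1939, §4 (4.2.2); Diamond–Shurman, proof of Prop. 5.9.1).

Theorems only; no definitions, no named facts. This is the `q`-expansion input of the
Rankin–Selberg unfolding for `S_k(Γ₀(N))` (`CuspFormRankinSelbergTrace`).

## References

* R. A. Rankin, Proc. Cambridge Philos. Soc. 35 (1939), 357–372, §4.
* F. Diamond, J. Shurman, *A First Course in Modular Forms*, GTM 228, §5.9.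
-/

noncomputable section

open scoped MatrixGroups ModularForm Topology
open Complex MeasureTheory Set Filter Function intervalIntegral
open UpperHalfPlane hiding I

namespace Literature.NumberTheory.EllipticCurves.ModularForms

/-- **Orthogonality of exponentials on `[0, h]`**: `∫₀ʰ e^{2πimx/h} dx = h` if `m = 0` and `0`
otherwise (`m ∈ ℤ`, `h > 0`). [folklore] -/
theorem integral_exp_two_pi_mul_I_mul {h : ℝ} (hh : 0 < h) (m : ℤ) :
    ∫ x in (0 : ℝ)..h, Complex.exp (2 * Real.pi * I * m / h * x) =
      if m = 0 then (h : ℂ) else 0 := by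
  split_ifs with hm
  · simp [hm]
  · have hc : (2 * Real.pi * I * m / h : ℂ) ≠ 0 := by
      have h1 : (2 * Real.pi : ℂ) ≠ 0 := by exact_mod_cast Real.two_pi_pos.ne'
      have h2 : (m : ℂ) ≠ 0 := by exact_mod_cast hm
      have h3 : (h : ℂ) ≠ 0 := by exact_mod_cast hh.ne'
      simp [h1, h2, h3, I_ne_zero]
    rw [integral_exp_mul_complex hc]
    have h3 : (h : ℂ) ≠ 0 := by exact_mod_cast hh.ne'
    have e1 : Complex.exp (2 * Real.pi * I * m / h * h) = 1 := by
      rw [div_mul_cancel₀ _ h3, show (2 * Real.pi * I * m : ℂ) = m * (2 * Real.pi * I) by ring]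
      exact Complex.exp_int_mul_two_pi_mul_I m
    simp [e1]

namespace IsCuspFunction

variable {h : ℝ} {φ : ℍ → ℂ} (hφ : IsCuspFunction h φ)
include hφ

/-- **The `q`-expansion along a horocycle**: `φ(x + it) = Σₙ cₙ e^{-2πnt/h} e^{2πinx/h}`
(`t > 0`, `x ∈ ℝ`). [folklore] -/
theorem hasSum_horizontal {t : ℝ} (ht : 0 < t) (x : ℝ) :
    HasSum (fun n : ℕ ↦ (qExpansion h φ).coeff n * (Real.exp (-(2 * Real.pi * n / h) * t) : ℂ) *
        Complex.exp (2 * Real.pi * I * n / h * x)) (φ (ofComplex ((x : ℂ) + t * I))) := by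
  have him : 0 < ((x : ℂ) + t * I).im := by simpa using ht
  have h1 := hφ.hasSum ⟨(x : ℂ) + t * I, him⟩
  rw [ofComplex_apply_of_im_pos him]
  convert h1 using 2 with n
  rw [UpperHalfPlane.coe_mk, qParam_add_mul_I_pow]
  have e : Periodic.qParam h (x : ℂ) ^ n = Complex.exp (2 * Real.pi * I * n / h * x) := by
    rw [Periodic.qParam, ← Complex.exp_nat_mul]
    congr 1
    ring
  rw [e]
  ring

/-- The horizontal section `x ↦ φ(x + it)` is continuous (`t > 0`). [folklore] -/
theorem continuous_horizontal {t : ℝ} (ht : 0 < t) :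
    Continuous fun x : ℝ ↦ φ (ofComplex ((x : ℂ) + t * I)) := by
  have h1 : Continuous fun x : ℝ ↦ ((x : ℂ) + t * I) := by fun_prop
  have h2 : ∀ x : ℝ, ((x : ℂ) + t * I) ∈ {z : ℂ | 0 < z.im} := fun x ↦ by simpa using ht
  exact hφ.continuousOn_comp_ofComplex.comp_continuous h1 h2

/-- **Fourier coefficients along a horocycle.** For `t > 0` the `n`-th Fourier coefficient of
the `h`-periodic function `x ↦ φ(x + it)` on `[0, h]` is `cₙ e^{-2πnt/h}` for `n ≥ 0` and `0` for
`n < 0` (termwise integration of the `q`-expansion against `e^{-2πinx/h}`; Diamond–Shurman,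
proof of Prop. 5.9.1; Rankin 1939, §4). [folklore] -/
theorem fourierCoeffOn_horizontal {t : ℝ} (ht : 0 < t) (n : ℤ) :
    fourierCoeffOn hφ.pos (fun x : ℝ ↦ φ (ofComplex ((x : ℂ) + t * I))) n =
      if 0 ≤ n then
        (qExpansion h φ).coeff n.toNat * (Real.exp (-(2 * Real.pi * n.toNat / h) * t) : ℂ)
      else 0 := by
  have hh := hφ.pos
  set c : ℕ → ℂ := fun m ↦ (qExpansion h φ).coeff m with hc
  set r : ℝ := Real.exp (-(2 * Real.pi / h) * t) with hr
  have hr0 : 0 ≤ r := (Real.exp_pos _).le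
  have hr1 : r < 1 := Real.exp_lt_one_iff.mpr (by
    have : 0 < 2 * Real.pi / h * t := by positivity
    linarith)
  -- the terms after multiplication by `e^{-2πinx/h}`
  set F : ℕ → ℝ → ℂ := fun m x ↦ c m * (Real.exp (-(2 * Real.pi * m / h) * t) : ℂ) *
    Complex.exp (2 * Real.pi * I * ((m : ℤ) - n : ℤ) / h * x) with hF
  have hexp_le : ∀ m : ℕ, Real.exp (-(2 * Real.pi * m / h) * t) ≤ r ^ m := by
    intro m
    rw [hr, ← Real.exp_nat_mul]
    refine Real.exp_le_exp.mpr (le_of_eq ?_)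
    ring
  have hFle : ∀ (m : ℕ) (x : ℝ), ‖F m x‖ ≤ ‖c m‖ * r ^ m := by
    intro m x
    rw [hF]
    dsimp only
    rw [norm_mul, norm_mul, Complex.norm_real, Real.norm_of_nonneg (Real.exp_pos _).le,
      Complex.norm_exp]
    have : (2 * Real.pi * I * (((m : ℤ) - n : ℤ) : ℂ) / h * x).re = 0 := by
      simp [Complex.div_re, Complex.mul_re, Complex.mul_im]
    rw [this, Real.exp_zero, mul_one]
    exact mul_le_mul_of_nonneg_left (hexp_le m) (norm_nonneg _)
  have hsum : Summable fun m : ℕ ↦ ‖c m‖ * r ^ m := hφ.summable_norm_coeff_mul_pow hr0 hr1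
  -- the pointwise expansion of the integrand
  have hpt : ∀ x : ℝ, HasSum (fun m ↦ F m x)
      (Complex.exp (-(2 * Real.pi * I * n / h * x)) * φ (ofComplex ((x : ℂ) + t * I))) := by
    intro x
    have h1 := (hφ.hasSum_horizontal ht x).mul_left (Complex.exp (-(2 * Real.pi * I * n / h * x)))
    have efun : (fun m ↦ F m x) = fun m : ℕ ↦ Complex.exp (-(2 * Real.pi * I * n / h * x)) *
        ((qExpansion h φ).coeff m * (Real.exp (-(2 * Real.pi * m / h) * t) : ℂ) *
          Complex.exp (2 * Real.pi * I * m / h * x)) := by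
      funext m
      rw [hF]
      dsimp only
      have e : Complex.exp (2 * Real.pi * I * (((m : ℤ) - n : ℤ) : ℂ) / h * x) =
          Complex.exp (-(2 * Real.pi * I * n / h * x)) * Complex.exp (2 * Real.pi * I * m / h * x) := by
        rw [← Complex.exp_add]
        congr 1
        push_cast
        ring
      rw [e]
      ring
    rw [efun]
    exact h1
  -- termwise integration over `[0, h]`
  have hint : HasSum (fun m ↦ ∫ x in (0 : ℝ)..h, F m x)
      (∫ x in (0 : ℝ)..h, Complex.exp (-(2 * Real.pi * I * n / h * x)) *
        φ (ofComplex ((x : ℂ) + t * I))) := by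
    refine intervalIntegral.hasSum_integral_of_dominated_convergence
      (fun m _ ↦ ‖c m‖ * r ^ m) (fun m ↦ ?_) (fun m ↦ ae_of_all _ fun x _ ↦ hFle m x)
      (ae_of_all _ fun x _ ↦ hsum) intervalIntegrable_const (ae_of_all _ fun x _ ↦ hpt x)
    refine Continuous.aestronglyMeasurable ?_
    rw [hF]
    fun_prop
  -- each term integrates to `cₘ e^{-2πmt/h} · h [m = n]`
  have hterm : ∀ m : ℕ, ∫ x in (0 : ℝ)..h, F m x =
      if (m : ℤ) = n then c m * (Real.exp (-(2 * Real.pi * m / h) * t) : ℂ) * h else 0 := by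
    intro m
    rw [hF]
    dsimp only
    rw [intervalIntegral.integral_const_mul, integral_exp_two_pi_mul_I_mul hh]
    by_cases hmn : (m : ℤ) = n
    · rw [if_pos (sub_eq_zero.mpr hmn), if_pos hmn]
    · rw [if_neg (sub_ne_zero.mpr hmn), if_neg hmn, mul_zero]
  simp_rw [hterm] at hint
  -- evaluate the sum
  have hval : HasSum (fun m : ℕ ↦ if (m : ℤ) = n then
      c m * (Real.exp (-(2 * Real.pi * m / h) * t) : ℂ) * h else 0)
      (if 0 ≤ n then c n.toNat * (Real.exp (-(2 * Real.pi * n.toNat / h) * t) : ℂ) * h else 0) := by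
    by_cases hn : 0 ≤ n
    · rw [if_pos hn]
      have key : ∀ m : ℕ, m ≠ n.toNat → (if (m : ℤ) = n then
          c m * (Real.exp (-(2 * Real.pi * m / h) * t) : ℂ) * h else 0) = 0 := by
        intro m hm
        rw [if_neg]
        intro hmn
        exact hm (by rw [← hmn, Int.toNat_natCast])
      convert hasSum_single n.toNat key using 1
      rw [if_pos (Int.toNat_of_nonneg hn)]
    · rw [if_neg hn]
      convert hasSum_zero with m
      rw [if_neg]
      intro hmn
      exact hn (hmn ▸ Int.natCast_nonneg m)
  have heq := hint.unique hval
  -- assemble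
  rw [fourierCoeffOn_eq_integral]
  have hI : ∫ x in (0 : ℝ)..h, fourier (-n) (x : AddCircle (h - 0)) • φ (ofComplex ((x : ℂ) + t * I)) =
      ∫ x in (0 : ℝ)..h, Complex.exp (-(2 * Real.pi * I * n / h * x)) *
        φ (ofComplex ((x : ℂ) + t * I)) := by
    refine intervalIntegral.integral_congr fun x _ ↦ ?_
    simp only [fourier_coe_apply, smul_eq_mul, Int.cast_neg, sub_zero]
    congr 1
    congr 1
    ring
  rw [hI, heq, sub_zero]
  split_ifs with hn
  · rw [Complex.real_smul]
    have : (h : ℂ) ≠ 0 := by exact_mod_cast hh.ne'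
    push_cast
    field_simp
    rfl
  · simp

/-- **Parseval's formula along a horocycle** for a cuspidal `q`-series of period `h`:
`∫₀ʰ |φ(x + it)|² dx = h Σₙ |cₙ|² e^{-4πnt/h}` for `t > 0` (Rankin 1939, §4, (4.2.2);
Diamond–Shurman, proof of Prop. 5.9.1), from Mathlib's Parseval identity on `[0, h]`
(`hasSum_sq_fourierCoeffOn`) and `fourierCoeffOn_horizontal`. [cite: Rankin1939, §4] -/
theorem hasSum_norm_sq_horizontal {t : ℝ} (ht : 0 < t) :
    HasSum (fun n : ℕ ↦ ‖(qExpansion h φ).coeff n‖ ^ 2 * Real.exp (-(4 * Real.pi * n / h) * t))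
      (h⁻¹ * ∫ x in (0 : ℝ)..h, ‖φ (ofComplex ((x : ℂ) + t * I))‖ ^ 2) := by
  have hh := hφ.pos
  set G : ℝ → ℂ := fun x ↦ φ (ofComplex ((x : ℂ) + t * I)) with hG
  have hGc : Continuous G := hφ.continuous_horizontal ht
  obtain ⟨B, hB⟩ := isCompact_Icc.exists_bound_of_continuousOn (s := Icc (0 : ℝ) h) hGc.continuousOn
  have hL2 : MemLp G 2 (volume.restrict (Ioc 0 h)) :=
    MemLp.of_bound hGc.aestronglyMeasurable B
      ((ae_restrict_iff' measurableSet_Ioc).mpr (ae_of_all _ fun x hx ↦ hB x (Ioc_subset_Icc_self hx)))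
  have hP := hasSum_sq_fourierCoeffOn hh hL2
  rw [sub_zero, smul_eq_mul] at hP
  -- drop the vanishing negative coefficients
  have hsupp : ∀ i : ℤ, i ∉ Set.range (Nat.cast : ℕ → ℤ) →
      ‖fourierCoeffOn hh G i‖ ^ 2 = 0 := by
    intro i hi
    have hi' : ¬ 0 ≤ i := fun h0 ↦ hi ⟨i.toNat, Int.toNat_of_nonneg h0⟩
    rw [hG, hφ.fourierCoeffOn_horizontal ht i, if_neg hi', norm_zero, zero_pow two_ne_zero]
  have hP' := (Function.Injective.hasSum_iff Nat.cast_injective hsupp).mpr hP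
  convert hP' using 2 with n
  simp only [Function.comp_apply, hG]
  rw [hφ.fourierCoeffOn_horizontal ht, if_pos (Int.natCast_nonneg n), Int.toNat_natCast, norm_mul,
    mul_pow, Complex.norm_real, Real.norm_of_nonneg (Real.exp_pos _).le, ← Real.exp_nat_mul]
  congr 1
  rw [show ((2 : ℕ) : ℝ) = 2 by norm_num]
  congr 1
  ring

/-- **Parseval, integrated form**: `∫₀ʰ |φ(x + it)|² dx = h Σₙ |cₙ|² e^{-4πnt/h}` (`t > 0`), the
series being summable. [cite: Rankin1939, §4] -/
theorem integral_norm_sq_horizontal {t : ℝ} (ht : 0 < t) :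
    ∫ x in (0 : ℝ)..h, ‖φ (ofComplex ((x : ℂ) + t * I))‖ ^ 2 =
      h * ∑' n : ℕ, ‖(qExpansion h φ).coeff n‖ ^ 2 * Real.exp (-(4 * Real.pi * n / h) * t) := by
  have hh := hφ.pos
  rw [(hφ.hasSum_norm_sq_horizontal ht).tsum_eq, ← mul_assoc, mul_inv_cancel₀ hh.ne', one_mul]

/-- Summability of `Σₙ |cₙ|² e^{-4πnt/h}` (`t > 0`). [folklore] -/
theorem summable_norm_sq_mul_exp {t : ℝ} (ht : 0 < t) :
    Summable fun n : ℕ ↦ ‖(qExpansion h φ).coeff n‖ ^ 2 * Real.exp (-(4 * Real.pi * n / h) * t) :=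
  (hφ.hasSum_norm_sq_horizontal ht).summable

end IsCuspFunction

end Literature.NumberTheory.EllipticCurves.ModularForms

end
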